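import Literature.AlgebraicGeometry.HodgeTheory.GysinKernelSplit
import Literature.AlgebraicGeometry.HodgeTheory.GysinKernelWeights
import Literature.AlgebraicGeometry.HodgeTheory.ComplexPointsLocallyContractible
import Literature.AlgebraicGeometry.HodgeTheory.RationalClassesRingChange
import Literature.AlgebraicGeometry.HodgeTheory.LefschetzOneOneChowClosed
import HarnessLib

/-!
# Deligne, *Hodge III*, Prop. 8.2.7 (the named fact `Deligne1974_ker_pullback_eq_ker_pullback_resolution`)
# is EQUIVALENT to its rational core: "`Ker(i^*) = Ker((π ≫ i)^*)` on `Hᵠ(X(ℂ); ℚ)`"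

Theorems-only companion of `GysinKernelSplit.lean` (the named fact: for `X` smooth projective
over `ℂ`, a finite family `g j : Y j ⟶ X` from smooth projective `Y j`, a complex class
`x' ∈ Hᵠ(X(ℂ); ℂ)` killed by every `(g j)(ℂ)^*` vanishes on an open neighbourhood of
`{P | pt P ∈ ⋃ j, g_j(Y j)}`) and of `GysinKernelSplitProofs.lean` (the named fact from a package of
mixed Hodge structures `M : Motives.MixedHodgeStructureOfPair ℂ` with Deligne's Prop. 8.2.5 for it).

This file strips the statement of the named fact of everything the tree already PROVES — the
passage `ℚ ↦ ℂ` (`complexBetti_map_eq_zero_of_rat`: rational classes span, `ℂ/ℚ` flat), the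
closed subscheme carried by the joint image (`exists_closedSubscheme_factor`) and tautness of
`Z(ℂ)` in `X(ℂ)` (local contractibility of complex projective algebraic sets,
`locallyContractibleSpace_complexPoints_of_isSmoothProjective`, now unconditional) — and shows that
what is left is EXACTLY Deligne's printed statement over `ℚ`, free of any mixed-Hodge vocabulary:

> (**rational core**, Prop. 8.2.7 with `Y := X` smooth projective, `X := Z`, `X̃ := ⊔ Y j`)
> for `X` smooth projective, `i : Z ↪ X` a closed subscheme and `π j : Y j ⟶ Z` a finite,
> jointly surjective family from smooth projective varieties, every `v ∈ Hᵠ(X(ℂ); ℚ)` with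
> `(π j ≫ i)(ℂ)^* v = 0` for all `j` has `i(ℂ)^* v = 0` ("les noyaux de `f^*` et de `(fπ)^*`
> dans `Hⁿ(Y, ℚ)` sont égaux", p. 40).

* `Deligne1974_ker_pullback_eq_ker_pullback_resolution_of_rat` — the named fact from its rational
  core;
* `rat_core_of_Deligne1974_ker_pullback_eq_ker_pullback_resolution` — conversely the named fact
  implies the rational core (`i(ℂ)` lands in every neighbourhood of `{P | pt P ∈ i(Z)}`;
  `Hᵠ(Z(ℂ); ℚ) ↪ Hᵠ(Z(ℂ); ℂ)`, `ringChange_rat_injective`);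
* `Deligne1974_ker_pullback_eq_ker_pullback_resolution_iff_rat` — the equivalence.

So ANY proof of the rational core discharges the named fact (and with it Cor. 8.2.8,
`Deligne1974_ker_restrictCompl_eq_iSup_range_complexGysin_holds_of`): Deligne's (mixed Hodge
structures by proper hypercoverings, Prop. 8.2.5 and strictness — the route of
`GysinKernelSplitProofs`), or a direct one on the tree's compact Kähler carriers (global
`∂∂̄`-lemma on the pieces of a cubical hyperresolution / of the nerve of a normal-crossing
configuration, where the obstruction classes are simultaneously of types `(a, b+1)` and
`(a+1, b)`, hence zero by the Hodge decomposition `Motives.isInternal_hodgePQ_holds`).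
No definitions, no named facts (D-0026).

## References

* [DeligneHodgeIII1974] P. Deligne, Théorie de Hodge III, Publ. Math. IHÉS 44 (1974), Prop. 8.2.5,
  Prop. 8.2.7, Cor. 8.2.8 (p. 40).
* [VoisinHodgeI2002] C. Voisin, Hodge Theory and Complex Algebraic Geometry I, CUP 2002, §7.1.1
  (`Hᵏ(X, ℂ) = Hᵏ(X, ℚ) ⊗ ℂ`).
* [Spanier1981] E. H. Spanier, Algebraic Topology, Springer 1981, Ch. 6 §1 Thm. 10 (tautness).
* [DeligneGriffithsMorganSullivan1975] P. Deligne, P. Griffiths, J. Morgan, D. Sullivan, Real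
  homotopy theory of Kähler manifolds, Invent. Math. 29 (1975), §5 (the `∂∂̄`-lemma), for the
  remark on the direct route.
-/

noncomputable section

open CategoryTheory AlgebraicGeometry
open Literature.AlgebraicTopology.SingularHomology

namespace Literature.AlgebraicGeometry.HodgeTheory

open Literature.AlgebraicGeometry.Motives

/-- **The named fact `Deligne1974_ker_pullback_eq_ker_pullback_resolution` (Hodge III Prop. 8.2.7
in Čech form) from its rational core.** ASSUME (`hcore`): for `X` smooth projective, `i : Z ↪ X`
a closed subscheme, `π j : Y j ⟶ Z` a finite, jointly surjective family from smooth projective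
varieties and `v ∈ Hᵠ(X(ℂ); ℚ)` with `(π j ≫ i)(ℂ)^* v = 0` for all `j`, one has `i(ℂ)^* v = 0`
(Deligne: "les noyaux de `f^*` et de `(fπ)^*` dans `Hⁿ(Y, ℚ)` sont égaux"). THEN a complex class
`x' ∈ Hᵠ(X(ℂ); ℂ)` killed by every `(g j)(ℂ)^*`, `g j : Y j ⟶ X` a finite family from smooth
projective varieties, vanishes on an open neighbourhood of `{P | pt P ∈ ⋃ j, g_j(Y j)}`: factor
the `g j` through the closed subscheme `Z` carried by the joint image
(`exists_closedSubscheme_factor`), tensor the core with `ℂ` (`complexBetti_map_eq_zero_of_rat`) and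
pass to the germ of `Z(ℂ)` by tautness (`exists_isOpen_map_subsetIncl_eq_zero_of_complexBetti_map_eq_zero`,
the local contractibility of `Z(ℂ)` being `locallyContractibleSpace_complexPoints_of_isSmoothProjective`).
[cite: DeligneHodgeIII1974, Prop. 8.2.7 (p. 40)] [cite: VoisinHodgeI2002, §7.1.1]
[cite: Spanier1981, Ch. 6 §1 Thm. 10] -/
theorem Deligne1974_ker_pullback_eq_ker_pullback_resolution_of_rat
    (hcore : ∀ ⦃n : ℕ⦄ ⦃X : Motives.SchemeOver ℂ⦄, IsSmoothProjective n X →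
      ∀ ⦃Z : Motives.SchemeOver ℂ⦄ (i : Z ⟶ X), IsClosedImmersion i.left →
      ∀ ⦃ι : Type⦄ [Finite ι] ⦃m : ι → ℕ⦄ ⦃Y : ι → Motives.SchemeOver ℂ⦄,
        (∀ j, IsSmoothProjective (m j) (Y j)) → ∀ (π : ∀ j, Y j ⟶ Z),
        (⋃ j, Set.range (π j).left.base) = Set.univ →
        ∀ (q : ℕ) (v : singularCohomology ℚ ℚ (ComplexPoints X) q),
          (∀ j, singularCohomology.map ℚ ℚ (AlgPoints.mapContinuous (L := ℂ) (π j ≫ i)) q v = 0) →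
            singularCohomology.map ℚ ℚ (AlgPoints.mapContinuous (L := ℂ) i) q v = 0) :
    Deligne1974_ker_pullback_eq_ker_pullback_resolution := by
  intro n X hX ι _ m Y hY g q x' hx'
  obtain ⟨Z, i, hi, π, hπ, hrange⟩ := exists_closedSubscheme_factor hX hY g
  haveI := hi
  -- the family `π` is jointly surjective onto `Z`
  have hsurj : (⋃ j, Set.range (π j).left.base) = Set.univ := by
    refine Set.eq_univ_of_forall fun z ↦ ?_
    have hz : i.left.base z ∈ ⋃ j, Set.range (g j).left.base := hrange ▸ ⟨z, rfl⟩
    obtain ⟨j, y, hy⟩ := Set.mem_iUnion.1 hz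
    refine Set.mem_iUnion.2 ⟨j, y, i.left.isClosedEmbedding.injective ?_⟩
    change ((π j ≫ i).left).base y = i.left.base z
    rw [hπ j]
    exact hy
  -- Prop. 8.2.7 over `ℚ`: the rational core, for the factorisation `g j = π j ≫ i`
  have hQ : ∀ v : singularCohomology ℚ ℚ (ComplexPoints X) q,
      (∀ j, singularCohomology.map ℚ ℚ (AlgPoints.mapContinuous (L := ℂ) (g j)) q v = 0) →
        singularCohomology.map ℚ ℚ (AlgPoints.mapContinuous (L := ℂ) i) q v = 0 :=
    fun v hv ↦ hcore hX i hi hY π hsurj q v fun j ↦ by rw [hπ j]; exact hv j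
  -- `⊗ ℂ`, then tautness of `Z(ℂ)` in `X(ℂ)` (local contractibility: proved in the tree)
  have hvan := complexBetti_map_eq_zero_of_rat hX g i q hQ x' hx'
  obtain ⟨V, hVo, hKV, hV⟩ := exists_isOpen_map_subsetIncl_eq_zero_of_complexBetti_map_eq_zero
    hX i (locallyContractibleSpace_complexPoints_of_isSmoothProjective hX _
      i.left.isClosedEmbedding.isClosed_range) x' hvan
  refine ⟨V, hVo, ?_, hV⟩
  rw [← hrange]
  exact hKV

/-- **Conversely, the named fact implies its rational core.** Given `i : Z ↪ X` closed, a jointly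
surjective family `π j : Y j ⟶ Z` from smooth projective varieties and `v ∈ Hᵠ(X(ℂ); ℚ)` killed
by every `(π j ≫ i)(ℂ)^*`: the complexified class `x' = v ⊗ 1` is killed by every
`(π j ≫ i)(ℂ)^*` (`ringChange_map`), so by the named fact it vanishes on an open `V ⊇
{P | pt P ∈ ⋃ j, (π j ≫ i)(Y j)} = {P | pt P ∈ i(Z)}`; the continuous map `i(ℂ) : Z(ℂ) → X(ℂ)`
lands in that set (`range_map_eq_setOf_pt_mem_range`), hence factors through `V`, so
`i(ℂ)^* x' = 0`, i.e. `(i(ℂ)^* v) ⊗ 1 = 0`, and `Hᵠ(Z(ℂ); ℚ) → Hᵠ(Z(ℂ); ℂ)` is injective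
(`ringChange_rat_injective`). [cite: DeligneHodgeIII1974, Prop. 8.2.7 (p. 40)]
[cite: HatcherAT2002, §3.1 Thm. 3.2 and p. 198] -/
theorem rat_core_of_Deligne1974_ker_pullback_eq_ker_pullback_resolution
    (h : Deligne1974_ker_pullback_eq_ker_pullback_resolution)
    ⦃n : ℕ⦄ ⦃X : Motives.SchemeOver ℂ⦄ (hX : IsSmoothProjective n X)
    ⦃Z : Motives.SchemeOver ℂ⦄ (i : Z ⟶ X) (hi : IsClosedImmersion i.left)
    ⦃ι : Type⦄ [Finite ι] ⦃m : ι → ℕ⦄ ⦃Y : ι → Motives.SchemeOver ℂ⦄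
    (hY : ∀ j, IsSmoothProjective (m j) (Y j)) (π : ∀ j, Y j ⟶ Z)
    (hsurj : (⋃ j, Set.range (π j).left.base) = Set.univ)
    (q : ℕ) (v : singularCohomology ℚ ℚ (ComplexPoints X) q)
    (hv : ∀ j, singularCohomology.map ℚ ℚ (AlgPoints.mapContinuous (L := ℂ) (π j ≫ i)) q v = 0) :
    singularCohomology.map ℚ ℚ (AlgPoints.mapContinuous (L := ℂ) i) q v = 0 := by
  haveI := hi
  -- the complexified class and the family `g j = π j ≫ i`
  set x' : complexBetti X q := singularCohomology.ringChange (algebraMap ℚ ℂ) (ComplexPoints X) q v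
    with hx'def
  have hx' : ∀ j, complexBetti.map (π j ≫ i) q x' = 0 := fun j ↦ by
    change singularCohomology.map ℂ ℂ (AlgPoints.mapContinuous (L := ℂ) (π j ≫ i)) q
      (singularCohomology.ringChange (algebraMap ℚ ℂ) (ComplexPoints X) q v) = 0
    rw [← ringChange_map, hv j, map_zero]
  obtain ⟨V, -, hZV, hV⟩ := h hX hY (fun j ↦ π j ≫ i) q x' hx'
  -- `⋃ j, (π j ≫ i)(Y j) = i(Z)` as sets of scheme points
  have hrange : (⋃ j, Set.range (π j ≫ i).left.base) = Set.range i.left.base := by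
    have e : ∀ j, Set.range (π j ≫ i).left.base = i.left.base '' Set.range (π j).left.base := by
      intro j
      rw [← Set.range_comp]
      rfl
    simp_rw [e, ← Set.image_iUnion, hsurj, Set.image_univ]
  rw [hrange] at hZV
  -- `i(ℂ)` factors through the inclusion of `V`
  have hmem : ∀ P : ComplexPoints Z, AlgPoints.mapContinuous (L := ℂ) i P ∈ V := fun P ↦
    hZV (show (AlgPoints.map (L := ℂ) i P).pt ∈ Set.range i.left.base from by
      have hP : AlgPoints.map (L := ℂ) i P ∈ Set.range (AlgPoints.map (L := ℂ) i) := ⟨P, rfl⟩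
      rw [range_map_eq_setOf_pt_mem_range (L := ℂ) i] at hP
      exact hP)
  let iV : C(ComplexPoints Z, V) :=
    ⟨fun P ↦ ⟨AlgPoints.mapContinuous (L := ℂ) i P, hmem P⟩,
      (AlgPoints.mapContinuous (L := ℂ) i).continuous.subtype_mk _⟩
  have hfac : (subsetIncl V).comp iV = AlgPoints.mapContinuous (L := ℂ) i := by
    ext P
    rfl
  have hC : singularCohomology.map ℂ ℂ (AlgPoints.mapContinuous (L := ℂ) i) q x' = 0 := by
    rw [← hfac, singularCohomology.map_comp, ModuleCat.comp_apply, hV, map_zero]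
  -- back to `ℚ`
  apply ringChange_rat_injective
  rw [map_zero, ringChange_map]
  exact hC

/-- **Hodge III Prop. 8.2.7 in Čech form ⟺ its rational core** (the two theorems above).
[cite: DeligneHodgeIII1974, Prop. 8.2.7 (p. 40)] -/
theorem Deligne1974_ker_pullback_eq_ker_pullback_resolution_iff_rat :
    Deligne1974_ker_pullback_eq_ker_pullback_resolution ↔
      ∀ ⦃n : ℕ⦄ ⦃X : Motives.SchemeOver ℂ⦄, IsSmoothProjective n X →
      ∀ ⦃Z : Motives.SchemeOver ℂ⦄ (i : Z ⟶ X), IsClosedImmersion i.left →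
      ∀ ⦃ι : Type⦄ [Finite ι] ⦃m : ι → ℕ⦄ ⦃Y : ι → Motives.SchemeOver ℂ⦄,
        (∀ j, IsSmoothProjective (m j) (Y j)) → ∀ (π : ∀ j, Y j ⟶ Z),
        (⋃ j, Set.range (π j).left.base) = Set.univ →
        ∀ (q : ℕ) (v : singularCohomology ℚ ℚ (ComplexPoints X) q),
          (∀ j, singularCohomology.map ℚ ℚ (AlgPoints.mapContinuous (L := ℂ) (π j ≫ i)) q v = 0) →
            singularCohomology.map ℚ ℚ (AlgPoints.mapContinuous (L := ℂ) i) q v = 0 :=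
  ⟨fun h _ _ hX _ i hi _ _ _ _ hY π hsurj q v hv ↦
      rat_core_of_Deligne1974_ker_pullback_eq_ker_pullback_resolution h hX i hi hY π hsurj q v hv,
    fun h ↦ Deligne1974_ker_pullback_eq_ker_pullback_resolution_of_rat h⟩

end Literature.AlgebraicGeometry.HodgeTheory

end
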